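import Mathlib
import Literature.NumberTheory.Automorphic.HyperbolicLaplaceSpectrum

/-!
# `C²` and the hyperbolic Laplacian transport under the reflection `z ↦ -z̄`

Stub P2a `stub_reflect_laplacian` of line `ParityPurePoint` (crux stmt-Langlands-15897,
`Summit.Langlands.Langlands.Theses.QuarterDeficit1951.QuarterFingerprintDeficit`), kernel-proved.

For `u : ℍ → ℂ` with `IsC2 u` (the extension `u ∘ ofComplex` is `C²` on the open upper half-plane):
`u ∘ R` is again `C²` there and `Δ(u ∘ R)(z) = (Δ u)(R z)` for Iwaniec's `Δ = y²(∂ₓ² + ∂_y²)`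
(`Literature.NumberTheory.Automorphic.hypLaplacian`), where `R z = -z̄ = UpperHalfPlane.J • z`.
Proof: on the open half-plane `(u ∘ R) ∘ ofComplex` agrees with `(u ∘ ofComplex) ∘ L` for the real-linear
ISOMETRY `L w = -w̄`; the Euclidean Laplacian is invariant under linear isometries (computed in the orthonormal
basis `v` and its image `v.map L`, with `ContinuousLinearEquiv.iteratedFDerivWithin_comp_right`), and
`Im (R z) = Im z`.
-/

set_option linter.dupNamespace false

noncomputable section

namespace Summit.Langlands.Langlands.Theorems.QuarterFingerprintDeficit

open scoped MatrixGroups ComplexConjugate InnerProductSpace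
open UpperHalfPlane Laplacian

/-- The reflection `w ↦ -w̄` of `ℂ` as a real-linear isometry. [folklore] -/
def reflLIE : ℂ ≃ₗᵢ[ℝ] ℂ := Complex.conjLIE.trans (LinearIsometryEquiv.neg ℝ)

@[simp] theorem reflLIE_apply (w : ℂ) : reflLIE w = -conj w := by
  simp [reflLIE, LinearIsometryEquiv.trans_apply, LinearIsometryEquiv.coe_neg]

/-- The Euclidean Laplacian on `ℂ ≅ ℝ²` is invariant under real-linear isometries:
`Δ (f ∘ L) x = (Δ f) (L x)` (no differentiability hypothesis). [folklore] -/
theorem laplacian_comp_linearIsometryEquiv (f : ℂ → ℂ) (L : ℂ ≃ₗᵢ[ℝ] ℂ) (x : ℂ) :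
    (Δ (f ∘ L)) x = (Δ f) (L x) := by
  set v := Complex.orthonormalBasisOneI with hv
  have h1 := congrFun (InnerProductSpace.laplacian_eq_iteratedFDeriv_orthonormalBasis (f ∘ L) v) x
  have h2 := congrFun (InnerProductSpace.laplacian_eq_iteratedFDeriv_orthonormalBasis f (v.map L)) (L x)
  rw [h1, h2]
  refine Finset.sum_congr rfl fun i _ => ?_
  have h := L.toContinuousLinearEquiv.iteratedFDerivWithin_comp_right f uniqueDiffOn_univ
    (Set.mem_univ (L.toContinuousLinearEquiv x)) 2
  simp only [Set.preimage_univ, iteratedFDerivWithin_univ,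
    LinearIsometryEquiv.coe_toContinuousLinearEquiv] at h
  rw [h, ContinuousMultilinearMap.compContinuousLinearMap_apply, OrthonormalBasis.map_apply]
  congr 1
  funext j
  fin_cases j <;> simp

/-- On the open upper half-plane, `(u ∘ R) ∘ ofComplex = (u ∘ ofComplex) ∘ (w ↦ -w̄)`. [folklore] -/
theorem comp_J_ofComplex_eq (u : ℍ → ℂ) {w : ℂ} (hw : 0 < w.im) :
    ((fun z => u (J • z)) ∘ ofComplex) w = ((u ∘ ofComplex) ∘ reflLIE) w := by
  have h2 : 0 < (-conj w).im := by simpa using hw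
  simp only [Function.comp_apply, reflLIE_apply]
  congr 1
  apply UpperHalfPlane.ext
  rw [coe_J_smul, ofComplex_apply_of_im_pos hw, ofComplex_apply_of_im_pos h2, coe_mk, coe_mk]

/-- **Stub P2a (proved).** `IsC2` and `hypLaplacian` transport under `R : z ↦ -z̄`. [folklore] -/
theorem stub_reflect_laplacian (u : UpperHalfPlane → ℂ) (hu : Literature.NumberTheory.Automorphic.IsC2 u) :
    Literature.NumberTheory.Automorphic.IsC2 (fun z => u (UpperHalfPlane.J • z)) ∧
    ∀ z : UpperHalfPlane,
      Literature.NumberTheory.Automorphic.hypLaplacian (fun w => u (UpperHalfPlane.J • w)) z =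
      Literature.NumberTheory.Automorphic.hypLaplacian u (UpperHalfPlane.J • z) := by
  have hmaps : Set.MapsTo (reflLIE : ℂ → ℂ) {w : ℂ | 0 < w.im} {w : ℂ | 0 < w.im} := by
    intro w hw
    simpa [reflLIE_apply] using hw
  constructor
  · -- C² : compose with the isometry, then correct on the open set
    unfold Literature.NumberTheory.Automorphic.IsC2 at hu ⊢
    have hcomp : ContDiffOn ℝ 2 ((u ∘ ofComplex) ∘ reflLIE) {w : ℂ | 0 < w.im} :=
      hu.comp reflLIE.contDiff.contDiffOn hmaps
    exact hcomp.congr fun w hw => comp_J_ofComplex_eq u hw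
  · intro z
    unfold Literature.NumberTheory.Automorphic.hypLaplacian
    have him : (J • z).im = z.im := by
      rw [← coe_im, coe_J_smul]; simp
    rw [him]
    congr 1
    -- Laplacians agree: local equality of the functions near `z`, then isometry invariance
    have hopen : IsOpen {w : ℂ | 0 < w.im} := isOpen_lt continuous_const Complex.continuous_im
    have hev : ((fun w => u (J • w)) ∘ ofComplex) =ᶠ[nhds (z : ℂ)] ((u ∘ ofComplex) ∘ reflLIE) := by
      filter_upwards [hopen.mem_nhds z.im_pos] with w hw
      exact comp_J_ofComplex_eq u hw
    rw [(InnerProductSpace.laplacian_congr_nhds hev).eq_of_nhds, laplacian_comp_linearIsometryEquiv,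
      reflLIE_apply, coe_J_smul]

end Summit.Langlands.Langlands.Theorems.QuarterFingerprintDeficit

end
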